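import Summits.CriticalPhenomena.SAWScalingLimit.Theorems.SAWDevelopingMapHexConjectureTailSplitFixedScale
import Summits.CriticalPhenomena.SAWScalingLimit.Theorems.SAWDevelopingMapHexConjectureCodedReflect
import Mathlib.Analysis.SpecificLimits.Basic
import HarnessLib

/-!
# Crux `HexConjecture` (stmt-CriticalPhenomena-0808), line `root-locality-replaces-loewner` (lead c8):
the window two-point lower bound from a TAIL FRACTION and a DROP of the triangle tail

Landing target:
`Summits/CriticalPhenomena/SAWScalingLimit/Theorems/SAWDevelopingMapHexConjectureWindowTwoPointOfTailFraction.lean`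
(`--supports stmt-CriticalPhenomena-0808`; registered stub `stub_windowTwoPoint_of_tailFraction_of_drop`).

The lever of the line after the c8 reshape is the WINDOW TWO-POINT LOWER BOUND WTLB (skeleton 2♮♮):
`triDl ⌊R/4⌋ ≤ C · Σ_{d ∈ [θa R, θb R]} Z_{B_R(x)}(s_x → t_{x+d e₀})`.  Besides Krachun–Panagiotis Cor. 3.1 + lower regularity (c6/c8 notes),
a second sufficient pair is recorded here as a theorem.  Write `coded_N(d)` for the critical floor-arch mass of the Duminil-Copin–Smirnov
trapezoid `S_{N+1,N+1}` at offset `d` (= `Z_{S_x(N)}(s_x → t_{x+d e₀})` at every root cell `x`).  Then WTLB follows from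

* TAILFRAC — a TAIL FRACTION: `∃ ε > 0 ∀ T ≫ 1 ∃ N: ε·triDl T ≤ Σ_{0<|d|≤N+1, |d|≥T+1} coded_N(d)` (a fixed fraction of the half-plane
  arches NOT contained in the lattice triangle `T_T` — which weigh `2(cos(π/8)/cos(3π/8))·triDl T` in all — END beyond `±T`, instead of
  leaving `T_T` and returning near the root), and
* DROP — `∃ 0 ≤ q < 1, Λ₀ ≥ 1 ∀ T ≫ 1: triDl(Λ₀T) ≤ q·triDl T` (the non-increasing triangle tail drops by a fixed factor over a bounded
  scale ratio: no long plateaus — UPPER regularity of the one sequence `triDl`),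

given the evenness `coded_N(−d) = coded_N(d)` (reflection symmetry, `stub_codedArchSum_reflect`).  Mechanism
(`windowTwoPointLowerBound_of_tailFraction_of_drop`): at `T ≈ θa R`, `T2 = ⌊R/4⌋` the fixed-scale split (`stub_tailSplit_fixedScale`,
file `…TailSplitFixedScale.lean`) bounds the strip's floor-arch tail beyond `±T` by twice the window two-point mass of the half-box over
`[T+1, T2]` plus `2κ₂·triDl(⌊R/3⌋−1) + κ₂·triDl T2 ≤ 3κ₂·triDl T2` (`κ₂ = 2cos(π/8)/cos(3π/8)`; far parts and beyond-window parts are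
triangle tails, `farArchMass_offsetSum_le_sub_triA`, `farOffsetMass_le_sub_triA`), and `k` iterated drops (`θa = 1/(8Λ₀^k)`) make
`3κ₂·triDl T2 ≤ 3κ₂ q^k·triDl T ≤ (ε/4)·triDl T`; so the window mass is at least `(3ε/8)·triDl T ≥ (3ε/8)·triDl ⌊R/4⌋`.
Both TAILFRAC and DROP are open (conjecturally `TAIL_T, triDl T ≍ T^{-1/4}`); DROP is NOT a consequence of Krachun–Panagiotis's
inequality (12), which excludes a plateau of scale ratio `Λ` only for `Λ > exp(C/D⁴)`.
Sources: GlazmanManolescu2019 (Lemma 4.1), arXiv:2310.17299 (Lemma 2.2, §3.3), DuminilCopinSmirnov2012 (Lemma 2).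
-/

noncomputable section

open scoped BigOperators Topology Classical
open Filter Set
open Literature.Probability.LatticeModels (HexVertex hexGraph hexCenter Site)
open Literature.Probability.RandomPlanarGeometry
open Literature.Probability.RandomPlanarGeometry.SAW
open Literature.Probability.RandomPlanarGeometry.SAW.HV
open Summit.CriticalPhenomena.SAWScalingLimit.Theorems.ObservableToSLE.FloorRatio

namespace Summit.CriticalPhenomena.SAWScalingLimit.Theorems.HexConjecture.RootLocality

/-! ### Iterated drop -/

/-- Iterating a drop `triDl(Λ₀T) ≤ q·triDl T` (`T ≥ T₀`, `Λ₀ ≥ 1`, `q ≥ 0`): `triDl(Λ₀^k T) ≤ q^k·triDl T`.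
[cite: GlazmanManolescu2019, §4.1 (D^Δ is decreasing)] -/
theorem triDl_iterated_drop {q : ℝ} (hq0 : 0 ≤ q) {Λ₀ T₀ : ℕ} (hΛ₀ : 1 ≤ Λ₀)
    (hD : ∀ T : ℕ, T₀ ≤ T → triDl (Λ₀ * T) ≤ q * triDl T) :
    ∀ (k T : ℕ), T₀ ≤ T → triDl (Λ₀ ^ k * T) ≤ q ^ k * triDl T := by
  intro k
  induction k with
  | zero => intro T _; simp
  | succ j ih =>
    intro T hT
    have hjT : T₀ ≤ Λ₀ ^ j * T := le_trans hT (Nat.le_mul_of_pos_left T (pow_pos hΛ₀ j))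
    calc triDl (Λ₀ ^ (j + 1) * T) = triDl (Λ₀ * (Λ₀ ^ j * T)) := by ring_nf
      _ ≤ q * triDl (Λ₀ ^ j * T) := hD _ hjT
      _ ≤ q * (q ^ j * triDl T) := mul_le_mul_of_nonneg_left (ih T hT) hq0
      _ = q ^ (j + 1) * triDl T := by ring

/-! ### The reduction -/

/-- **WTLB FROM A TAIL FRACTION AND A DROP.**  Evenness of the coded floor-arch sums in the offset, a tail fraction `ε` for the
strip's floor-arch mass beyond `±T` against `triDl T`, and a drop of `triDl` by a factor `q < 1` over a bounded scale ratio `Λ₀` imply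
the window two-point lower bound of the line (skeleton statement 2♮♮, verbatim), with `θa = 1/(8Λ₀^k)`, `θb = 1/4`, `C = 4/ε`, where
`3κ₂ q^k ≤ ε/4`. [cite: GlazmanManolescu2019, Lemma 4.1; DuminilCopinSmirnov2012, Lemma 2 and §3] -/
theorem windowTwoPointLowerBound_of_tailFraction_of_drop
    (hrefl : ∀ (N : ℕ) (d : ℤ), ∑ P ∈ (Literature.Probability.RandomPlanarGeometry.SAW.HV.midWalks (Literature.Probability.RandomPlanarGeometry.SAW.HV.stripV (N + 1) (N + 1))).filter (fun P => Literature.Probability.RandomPlanarGeometry.SAW.HV.finalDart P = ((-d, 0, false), (-d, -1, true)) ∨ Literature.Probability.RandomPlanarGeometry.SAW.HV.finalDart P = ((-d, -1, true), (-d, 0, false))), Literature.Probability.RandomPlanarGeometry.SAW.hexCriticalFugacity ^ Literature.Probability.RandomPlanarGeometry.SAW.HV.mwLen P = ∑ P ∈ (Literature.Probability.RandomPlanarGeometry.SAW.HV.midWalks (Literature.Probability.RandomPlanarGeometry.SAW.HV.stripV (N + 1) (N + 1))).filter (fun P => Literature.Probability.RandomPlanarGeometry.SAW.HV.finalDart P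 = ((d, 0, false), (d, -1, true)) ∨ Literature.Probability.RandomPlanarGeometry.SAW.HV.finalDart P = ((d, -1, true), (d, 0, false))), Literature.Probability.RandomPlanarGeometry.SAW.hexCriticalFugacity ^ Literature.Probability.RandomPlanarGeometry.SAW.HV.mwLen P)
    (hTF : ∃ ε : ℝ, 0 < ε ∧ ∃ T₀ : ℕ, ∀ T : ℕ, T₀ ≤ T → ∃ N : ℕ, ε * Literature.Probability.RandomPlanarGeometry.SAW.HV.triDl T ≤ ∑ d ∈ ((Finset.Icc (-((N : ℤ) + 1)) ((N : ℤ) + 1)).erase 0).filter (fun d => (T : ℤ) + 1 ≤ |d|), ∑ P ∈ (Literature.Probability.RandomPlanarGeometry.SAW.HV.midWalks (Literature.Probability.RandomPlanarGeometry.SAW.HV.stripV (N + 1) (N + 1))).filter (fun P => Literature.Probability.RandomPlanarGeometry.SAW.HV.finalDart P = ((d, 0, false), (d, -1, true)) ∨ Literature.Probability.RandomPlanarGeometry.SAW.HV.finalDart P = ((d, -1, true), (d, 0, false))), Literature.Probability.RandomPlanarGeometry.SAW.hexCriticalFugacity ^ Literature.Probability.RandomPlanarGeometry.SAW.HV.mwLen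 P)
    (hDrop : ∃ q : ℝ, 0 ≤ q ∧ q < 1 ∧ ∃ Λ₀ : ℕ, 1 ≤ Λ₀ ∧ ∃ T₀ : ℕ, ∀ T : ℕ, T₀ ≤ T → Literature.Probability.RandomPlanarGeometry.SAW.HV.triDl (Λ₀ * T) ≤ q * Literature.Probability.RandomPlanarGeometry.SAW.HV.triDl T) :
    ∃ θa θb C : ℝ, 0 < θa ∧ θa < θb ∧ θb ≤ 1 / 4 ∧ 0 < C ∧ ∃ R₀ : ℝ, 0 < R₀ ∧ ∀ R : ℝ, R₀ ≤ R →
      ∀ (x : Site 2) (B : Finset HexVertex) (S' : Finset ℤ),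
        (∀ v : HexVertex, v ∈ B ↔ (x 1 ≤ v.1 1 ∧
          dist (hexCenter v) (hexMidpoint s((x - Pi.single 1 1, 1), (x, 0))) ≤ R)) →
        (∀ d : ℤ, d ∈ S' ↔ (θa * R ≤ (d : ℝ) ∧ (d : ℝ) ≤ θb * R)) →
        triDl ⌊R / 4⌋₊ ≤ C * ∑ d ∈ S', ∑ γ : HexMidEdgeSAW B s((x - Pi.single 1 1, 1), (x, 0))
            s((x + Pi.single 0 d - Pi.single 1 1, 1), (x + Pi.single 0 d, 0)), hexCriticalFugacity ^ γ.length := by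
  obtain ⟨ε, hε, T₀, hTF⟩ := hTF
  obtain ⟨q, hq0, hq1, Λ₀, hΛ₀, T₀', hD⟩ := hDrop
  -- the constant of the triangle tails
  obtain ⟨κ₂, hκ₂⟩ : ∃ κ₂ : ℝ, κ₂ = 2 * (Real.cos (Real.pi / 8) / Real.cos (3 * Real.pi / 8)) := ⟨_, rfl⟩
  have hκ₂0 : 0 < κ₂ := by
    rw [hκ₂]; exact mul_pos two_pos (div_pos cos_pi_div_eight_pos cos_three_pi_div_eight_pos)
  -- the number of drops
  obtain ⟨k, hk⟩ : ∃ k : ℕ, q ^ k < ε / (12 * κ₂) := exists_pow_lt_of_lt_one (by positivity) hq1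
  have hqk0 : 0 ≤ q ^ k := pow_nonneg hq0 k
  have hk' : 3 * κ₂ * q ^ k ≤ ε / 4 := by
    have h := (lt_div_iff₀ (by positivity : (0 : ℝ) < 12 * κ₂)).1 hk
    nlinarith
  set M : ℕ := Λ₀ ^ k with hM
  have hM1 : 1 ≤ M := Nat.one_le_pow _ _ hΛ₀
  have hM1r : (1 : ℝ) ≤ M := by exact_mod_cast hM1
  have hMpos : (0 : ℝ) < M := by linarith
  have hMne : (M : ℝ) ≠ 0 := hMpos.ne'
  have h8M : (0 : ℝ) < 8 * M := by linarith
  have hT₀0 : (0 : ℝ) ≤ T₀ := Nat.cast_nonneg _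
  have hT₀'0 : (0 : ℝ) ≤ T₀' := Nat.cast_nonneg _
  -- the parameters
  refine ⟨1 / (8 * M), 1 / 4, 4 / ε, div_pos one_pos h8M, ?_, le_rfl, by positivity, ?_⟩
  · rw [div_lt_div_iff₀ h8M (by norm_num)]; nlinarith
  refine ⟨8 * M * (T₀ + T₀' + 2) + 24, by positivity, fun R hR x B S' hB hS' => ?_⟩
  have hR24 : (24 : ℝ) ≤ R := le_trans (by nlinarith) hR
  have hRpos : 0 < R := by linarith
  -- the scales `T ≈ θa R` and `T2 = ⌊R/4⌋`
  set y : ℝ := 1 / (8 * M) * R with hy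
  have hy0 : 0 ≤ y := by positivity
  have hyT : (T₀ : ℝ) + T₀' + 2 ≤ y := by
    rw [hy]
    have : (8 * (M : ℝ) * (T₀ + T₀' + 2)) ≤ R := le_trans (by linarith) hR
    calc (T₀ : ℝ) + T₀' + 2 = 1 / (8 * M) * (8 * M * (T₀ + T₀' + 2)) := by field_simp
      _ ≤ 1 / (8 * M) * R := mul_le_mul_of_nonneg_left this (by positivity)
  have hyR : 8 * (M : ℝ) * y = R := by rw [hy]; field_simp
  set T : ℕ := ⌈y⌉₊ - 1 with hT
  have hceil1 : 1 ≤ ⌈y⌉₊ := Nat.one_le_ceil_iff.2 (by linarith)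
  have hT1 : ((T + 1 : ℕ) : ℝ) = ⌈y⌉₊ := by
    rw [hT, Nat.sub_add_cancel hceil1]
  have hyle : y ≤ (T : ℝ) + 1 := by
    have := Nat.le_ceil y
    push_cast at hT1
    linarith
  have hTle : (T : ℝ) ≤ y := by
    have := Nat.ceil_lt_add_one hy0
    push_cast at hT1
    linarith
  have hTT₀ : T₀ ≤ T := by
    have : (T₀ : ℝ) ≤ T := by linarith
    exact_mod_cast this
  have hTT₀' : T₀' ≤ T := by
    have : (T₀' : ℝ) ≤ T := by linarith
    exact_mod_cast this
  set T2 : ℕ := ⌊R / 4⌋₊ with hT2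
  have hT2le : (T2 : ℝ) ≤ R / 4 := Nat.floor_le (by positivity)
  have hT2ge : R / 4 - 1 ≤ (T2 : ℝ) := by
    have := Nat.lt_floor_add_one (R / 4)
    linarith
  have hMT : ((M * T : ℕ) : ℝ) ≤ T2 := by
    push_cast
    calc (M : ℝ) * T ≤ M * y := mul_le_mul_of_nonneg_left hTle (by positivity)
      _ = R / 8 := by linarith [hyR]
      _ ≤ R / 4 - 1 := by linarith
      _ ≤ T2 := hT2ge
  have hMT' : M * T ≤ T2 := by exact_mod_cast hMT
  have hTT2 : T + 1 ≤ T2 := by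
    have h1 : (T : ℝ) + 1 ≤ T2 := by
      calc (T : ℝ) + 1 ≤ y + 1 := by linarith
        _ ≤ R / 8 + 1 := by nlinarith [hyR, hM1r, hy0]
        _ ≤ R / 4 - 1 := by linarith
        _ ≤ T2 := hT2ge
    exact_mod_cast h1
  have hT2' : T2 ≤ ⌊R / 3⌋₊ - 1 := by
    have h1 : T2 + 1 ≤ ⌊R / 3⌋₊ := by
      refine Nat.le_floor ?_
      push_cast
      linarith
    omega
  -- the tail fraction at `T`, the fixed-scale split
  obtain ⟨N, hN⟩ := hTF T hTT₀
  have hsplit := stub_tailSplit_fixedScale x N T T2 R B (hrefl N) (by linarith) hTT2 hT2le hB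
  -- the triangle tails in terms of `triDl`
  rw [inv_cos_sub_triA_eq_two_mul, inv_cos_sub_triA_eq_two_mul, ← hκ₂] at hsplit
  have hanti1 : triDl (⌊R / 3⌋₊ - 1) ≤ triDl T2 := triDl_antitone hT2'
  have hanti2 : triDl T2 ≤ triDl (M * T) := triDl_antitone hMT'
  have hdrop : triDl (M * T) ≤ q ^ k * triDl T := by
    rw [hM]; exact triDl_iterated_drop hq0 hΛ₀ hD k T hTT₀'
  have hanti3 : triDl T2 ≤ triDl T := triDl_antitone (by omega)
  have hDl0 : 0 ≤ triDl T := triDl_nonneg T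
  -- the window sum dominates the one in the split
  obtain ⟨W, hW⟩ : ∃ W : ℝ, W = ∑ d ∈ Finset.Icc ((T : ℤ) + 1) (T2 : ℤ),
      ∑ γ : HexMidEdgeSAW B s((x - Pi.single 1 1, 1), (x, 0))
        s((x + Pi.single 0 d - Pi.single 1 1, 1), (x + Pi.single 0 d, 0)), hexCriticalFugacity ^ γ.length := ⟨_, rfl⟩
  obtain ⟨W', hW'⟩ : ∃ W' : ℝ, W' = ∑ d ∈ S',
      ∑ γ : HexMidEdgeSAW B s((x - Pi.single 1 1, 1), (x, 0))
        s((x + Pi.single 0 d - Pi.single 1 1, 1), (x + Pi.single 0 d, 0)), hexCriticalFugacity ^ γ.length := ⟨_, rfl⟩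
  rw [← hW] at hsplit
  rw [← hW']
  have hWW' : W ≤ W' := by
    rw [hW, hW']
    refine Finset.sum_le_sum_of_subset_of_nonneg (fun d hd => ?_) fun d _ _ => archMass_nonneg _ _ _
    rw [Finset.mem_Icc] at hd
    rw [hS' d]
    constructor
    · calc 1 / (8 * (M : ℝ)) * R = y := rfl
        _ ≤ (T : ℝ) + 1 := hyle
        _ ≤ d := by exact_mod_cast hd.1
    · calc (d : ℝ) ≤ T2 := by exact_mod_cast hd.2
        _ ≤ R / 4 := hT2le
        _ = 1 / 4 * R := by ring
  have hW0 : 0 ≤ W' := by rw [hW']; exact Finset.sum_nonneg fun d _ => archMass_nonneg _ _ _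
  -- assemble: `ε·triDl T ≤ 2W + 3κ₂·triDl T2 ≤ 2W + (ε/4)·triDl T`
  have h3 : 3 * κ₂ * triDl T2 ≤ ε / 4 * triDl T := by
    calc 3 * κ₂ * triDl T2 ≤ 3 * κ₂ * (q ^ k * triDl T) :=
          mul_le_mul_of_nonneg_left (hanti2.trans hdrop) (mul_nonneg (by norm_num) hκ₂0.le)
      _ = (3 * κ₂ * q ^ k) * triDl T := by ring
      _ ≤ ε / 4 * triDl T := mul_le_mul_of_nonneg_right hk' hDl0
  have hmain : ε * triDl T ≤ 2 * W + ε / 4 * triDl T := by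
    have e1 : 2 * (κ₂ * triDl (⌊R / 3⌋₊ - 1)) + κ₂ * triDl T2 ≤ 3 * κ₂ * triDl T2 := by
      nlinarith [mul_le_mul_of_nonneg_left hanti1 hκ₂0.le]
    linarith [hN.trans hsplit]
  -- conclude
  have hT2ε : triDl T2 * ε ≤ triDl T * ε := mul_le_mul_of_nonneg_right hanti3 hε.le
  have hfin : triDl T2 ≤ 4 / ε * W' := by
    rw [div_mul_eq_mul_div, le_div_iff₀ hε]
    linarith [hmain, hWW', hW0, hT2ε]
  exact hfin

/-- **WTLB FROM TAILFRAC AND DROP** (the evenness discharged by `stub_codedArchSum_reflect`): the window two-point lower bound of the line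
from a tail fraction and a drop of the triangle tail alone. [cite: GlazmanManolescu2019, Lemma 4.1; DuminilCopinSmirnov2012, Lemma 2 and §3] -/
theorem windowTwoPointLowerBound_of_tailFraction_of_drop'
    (hTF : ∃ ε : ℝ, 0 < ε ∧ ∃ T₀ : ℕ, ∀ T : ℕ, T₀ ≤ T → ∃ N : ℕ, ε * Literature.Probability.RandomPlanarGeometry.SAW.HV.triDl T ≤ ∑ d ∈ ((Finset.Icc (-((N : ℤ) + 1)) ((N : ℤ) + 1)).erase 0).filter (fun d => (T : ℤ) + 1 ≤ |d|), ∑ P ∈ (Literature.Probability.RandomPlanarGeometry.SAW.HV.midWalks (Literature.Probability.RandomPlanarGeometry.SAW.HV.stripV (N + 1) (N + 1))).filter (fun P => Literature.Probability.RandomPlanarGeometry.SAW.HV.finalDart P = ((d, 0, false), (d, -1, true)) ∨ Literature.Probability.RandomPlanarGeometry.SAW.HV.finalDart P = ((d, -1, true), (d, 0, false))), Literature.Probability.RandomPlanarGeometry.SAW.hexCriticalFugacity ^ Literature.Probability.RandomPlanarGeometry.SAW.HV.mwLen P)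
    (hDrop : ∃ q : ℝ, 0 ≤ q ∧ q < 1 ∧ ∃ Λ₀ : ℕ, 1 ≤ Λ₀ ∧ ∃ T₀ : ℕ, ∀ T : ℕ, T₀ ≤ T → Literature.Probability.RandomPlanarGeometry.SAW.HV.triDl (Λ₀ * T) ≤ q * Literature.Probability.RandomPlanarGeometry.SAW.HV.triDl T) :
    ∃ θa θb C : ℝ, 0 < θa ∧ θa < θb ∧ θb ≤ 1 / 4 ∧ 0 < C ∧ ∃ R₀ : ℝ, 0 < R₀ ∧ ∀ R : ℝ, R₀ ≤ R →
      ∀ (x : Site 2) (B : Finset HexVertex) (S' : Finset ℤ),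
        (∀ v : HexVertex, v ∈ B ↔ (x 1 ≤ v.1 1 ∧
          dist (hexCenter v) (hexMidpoint s((x - Pi.single 1 1, 1), (x, 0))) ≤ R)) →
        (∀ d : ℤ, d ∈ S' ↔ (θa * R ≤ (d : ℝ) ∧ (d : ℝ) ≤ θb * R)) →
        triDl ⌊R / 4⌋₊ ≤ C * ∑ d ∈ S', ∑ γ : HexMidEdgeSAW B s((x - Pi.single 1 1, 1), (x, 0))
            s((x + Pi.single 0 d - Pi.single 1 1, 1), (x + Pi.single 0 d, 0)), hexCriticalFugacity ^ γ.length :=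
  windowTwoPointLowerBound_of_tailFraction_of_drop stub_codedArchSum_reflect hTF hDrop

/-- **Registered stub `stub_windowTwoPoint_of_tailFraction_of_drop`** (crux item stmt-CriticalPhenomena-0808, line
`root-locality-replaces-loewner`, lead c8): evenness of the coded floor-arch sums + TAILFRAC + DROP ⟹ the window two-point lower bound
(`windowTwoPointLowerBound_of_tailFraction_of_drop`). [cite: GlazmanManolescu2019, Lemma 4.1; DuminilCopinSmirnov2012, Lemma 2 and §3] -/
theorem stub_windowTwoPoint_of_tailFraction_of_drop : (∀ (N : ℕ) (d : ℤ), ∑ P ∈ (Literature.Probability.RandomPlanarGeometry.SAW.HV.midWalks (Literature.Probability.RandomPlanarGeometry.SAW.HV.stripV (N + 1) (N + 1))).filter (fun P => Literature.Probability.RandomPlanarGeometry.SAW.HV.finalDart P = ((-d, 0, false), (-d, -1, true)) ∨ Literature.Probability.RandomPlanarGeometry.SAW.HV.finalDart P = ((-d, -1, true), (-d, 0, false))), Literature.Probability.RandomPlanarGeometry.SAW.hexCriticalFugacity ^ Literature.Probability.RandomPlanarGeometry.SAW.HV.mwLen P = ∑ P ∈ (Literature.Probability.RandomPlanarGeometry.SAW.HV.midWalks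 (Literature.Probability.RandomPlanarGeometry.SAW.HV.stripV (N + 1) (N + 1))).filter (fun P => Literature.Probability.RandomPlanarGeometry.SAW.HV.finalDart P = ((d, 0, false), (d, -1, true)) ∨ Literature.Probability.RandomPlanarGeometry.SAW.HV.finalDart P = ((d, -1, true), (d, 0, false))), Literature.Probability.RandomPlanarGeometry.SAW.hexCriticalFugacity ^ Literature.Probability.RandomPlanarGeometry.SAW.HV.mwLen P) → (∃ ε : ℝ, 0 < ε ∧ ∃ T₀ : ℕ, ∀ T : ℕ, T₀ ≤ T → ∃ N : ℕ, ε * Literature.Probability.RandomPlanarGeometry.SAW.HV.triDl T ≤ ∑ d ∈ ((Finset.Icc (-((N : ℤ) + 1)) ((N : ℤ) + 1)).erase 0).filter (fun d => (T : ℤ) + 1 ≤ |d|), ∑ P ∈ (Literature.Probability.RandomPlanarGeometry.SAW.HV.midWalks (Literature.Probability.RandomPlanarGeometry.SAW.HV.stripV (N + 1) (N + 1))).filter (fun P => Literature.Probability.RandomPlanarGeometry.SAW.HV.finalDart P = ((d, 0, false), (d, -1, true)) ∨ Literature.Probability.RandomPlanarGeometry.SAW.HV.finalDart P = ((d, -1,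 true), (d, 0, false))), Literature.Probability.RandomPlanarGeometry.SAW.hexCriticalFugacity ^ Literature.Probability.RandomPlanarGeometry.SAW.HV.mwLen P) → (∃ q : ℝ, 0 ≤ q ∧ q < 1 ∧ ∃ Λ₀ : ℕ, 1 ≤ Λ₀ ∧ ∃ T₀ : ℕ, ∀ T : ℕ, T₀ ≤ T → Literature.Probability.RandomPlanarGeometry.SAW.HV.triDl (Λ₀ * T) ≤ q * Literature.Probability.RandomPlanarGeometry.SAW.HV.triDl T) → (∃ θa θb C : ℝ, 0 < θa ∧ θa < θb ∧ θb ≤ 1 / 4 ∧ 0 < C ∧ ∃ R₀ : ℝ, 0 < R₀ ∧ ∀ R : ℝ, R₀ ≤ R → ∀ (x : Literature.Probability.LatticeModels.Site 2) (B : Finset Literature.Probability.LatticeModels.HexVertex) (S' : Finset ℤ), (∀ v : Literature.Probability.LatticeModels.HexVertex, v ∈ B ↔ (x 1 ≤ v.1 1 ∧ dist (Literature.Probability.LatticeModels.hexCenter v) (Literature.Probability.RandomPlanarGeometry.SAW.hexMidpoint s((x - Pi.single 1 1, 1), (x, 0))) ≤ R)) → (∀ d : ℤ, d ∈ S' ↔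 (θa * R ≤ (d : ℝ) ∧ (d : ℝ) ≤ θb * R)) → Literature.Probability.RandomPlanarGeometry.SAW.HV.triDl ⌊R / 4⌋₊ ≤ C * ∑ d ∈ S', ∑ γ : Literature.Probability.RandomPlanarGeometry.SAW.HexMidEdgeSAW B s((x - Pi.single 1 1, 1), (x, 0)) s((x + Pi.single 0 d - Pi.single 1 1, 1), (x + Pi.single 0 d, 0)), Literature.Probability.RandomPlanarGeometry.SAW.hexCriticalFugacity ^ γ.length) :=
  fun hrefl hTF hDrop => windowTwoPointLowerBound_of_tailFraction_of_drop hrefl hTF hDrop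

end Summit.CriticalPhenomena.SAWScalingLimit.Theorems.HexConjecture.RootLocality

end
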